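import Literature.Geometry.Riemannian.RoundSphere
import Literature.Geometry.Riemannian.RiemannianDistance
import Literature.Geometry.Riemannian.ConstantCurvature
import Literature.Geometry.Riemannian.KillingHopfPositive
import Literature.Geometry.Riemannian.SphericalSpaceFormOfConstantCurvature
import Literature.Geometry.Riemannian.SectionalPinchingEstimate
import Literature.Geometry.Lorentzian.LeviCivitaProofs
import Literature.Geometry.Lorentzian.LeviCivitaCurvature
import Literature.Topology.FourManifolds.ClosedBall
import Literature.Topology.FourManifolds.PoincareThreeClassification
import Mathlib.Geometry.Manifold.Diffeomorph

/-!
# Crux `PEFillNearRound` (stmt-SmoothPoincare4-7997), line `Sketch`, helper piece `helper_rfg_constantCurvature` of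
# RoundFilled-general (= the registered `stub_roundFilled` of item stmt-SmoothPoincare4-18033
# `PEFillStandardSphere`: a round metric on ANY closed 4-manifold diffeomorphic to `S⁴` is the conformal
# infinity of a Poincaré–Einstein 5-manifold — hyperbolic 5-space transported along the Killing–Hopf isometry)

Sectional curvature `≡ 1` on orthonormal pairs determines the whole curvature tensor: `Rm = (g ∧ g)/2`, i.e. `HasConstantSectionalCurvatureWith ∇ 1` (Lee 2018, Prop. 8.36; O'Neill 1983, Cor. 3.42), via the tree's Berger estimate at `ε = 0` (`abs_curvatureForm_frame_sub_le`, SectionalPinchingEstimate.lean) on an orthonormal frame and 4-linearity.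
-/

noncomputable section

-- the prescribed namespace `Summit.<P>.<Sub>.…` duplicates `SmoothPoincare4` (P = Sub)
set_option linter.dupNamespace false

open scoped Manifold ContDiff Topology RealInnerProductSpace
open Set Function Metric Bundle TopologicalSpace Module
open Literature.Geometry.Lorentzian Literature.Geometry.Lorentzian.PseudoRiemannianMetric
open Literature.Geometry.Riemannian Literature.Topology.FourManifolds

namespace Summit.SmoothPoincare4.SmoothPoincare4.Cruxes.PEFillNearRound.RoundFilled

section General

variable {E : Type*} [NormedAddCommGroup E] [NormedSpace ℝ E] {H : Type*} [TopologicalSpace H]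
  {I : ModelWithCorners ℝ E H} {M : Type*} [TopologicalSpace M] [ChartedSpace H M]
  [IsManifold I ∞ M] {n : ℕ∞ω}
  {g : PseudoRiemannianMetric I n E (TangentSpace I : M → Type _)}
  {cov : CovariantDerivative I E (TangentSpace I : M → Type _)} {c : ℝ}

/-- **A 4-linear function vanishing on all 4-tuples of basis vectors vanishes identically**: the
slot-by-slot extension from a basis (two linear maps agreeing on a basis are equal,
`Basis.ext`), applied four times. -/
private theorem aux_ext_four {V : Type*} [AddCommGroup V] [Module ℝ V] {ι : Type*}
    (b : Basis ι ℝ V) {D : V → V → V → V → ℝ}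
    (h1 : ∀ Y Z W, IsLinearMap ℝ (fun X => D X Y Z W))
    (h2 : ∀ X Z W, IsLinearMap ℝ (fun Y => D X Y Z W))
    (h3 : ∀ X Y W, IsLinearMap ℝ (fun Z => D X Y Z W))
    (h4 : ∀ X Y Z, IsLinearMap ℝ (fun W => D X Y Z W))
    (h0 : ∀ i j k l, D (b i) (b j) (b k) (b l) = 0) (X Y Z W : V) : D X Y Z W = 0 := by
  -- one-slot extension from the basis
  have key : ∀ {f : V → ℝ}, IsLinearMap ℝ f → (∀ i, f (b i) = 0) → ∀ v, f v = 0 := by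
    intro f hf hf0 v
    have hzero : IsLinearMap.mk' f hf = 0 := b.ext fun i => by simpa using hf0 i
    simpa using LinearMap.congr_fun hzero v
  have s1 : ∀ i j k W, D (b i) (b j) (b k) W = 0 := fun i j k => key (h4 _ _ _) (h0 i j k)
  have s2 : ∀ i j Z W, D (b i) (b j) Z W = 0 := fun i j Z W =>
    key (h3 _ _ W) (fun k => s1 i j k W) Z
  have s3 : ∀ i Y Z W, D (b i) Y Z W = 0 := fun i Y Z W =>
    key (h2 _ Z W) (fun j => s2 i j Z W) Y
  exact key (h1 Y Z W) (fun i => s3 i Y Z W) X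

/-- **Sectional curvatures determine the curvature tensor, pointwise** (Lee 2018, Prop. 8.36;
O'Neill 1983, Ch. 3, Cor. 3.42): if `g_x` is positive definite, `cov` is a Levi-Civita connection of
the `C^n` metric `g` (`n ≥ 2`), the model space has dimension `m`, and `Rm(X,Y,Y,X) = c` for every
`g_x`-orthonormal pair, then `Rm(X,Y,Z,W) = c (g(Y,Z) g(X,W) - g(X,Z) g(Y,W))` for all
`X Y Z W ∈ T_x M`: the Berger–Karcher estimate `abs_curvatureForm_frame_sub_le` with `ε = 0` gives
the identity on a `g_x`-orthonormal basis, and both sides are 4-linear. -/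
private theorem aux_curvatureForm_eq_of_sectional [FiniteDimensional ℝ E] [CompleteSpace E]
    (h : g.IsLeviCivita cov) (hn : 2 ≤ n) {x : M}
    (hpos : ∀ v : TangentSpace I x, v ≠ 0 → 0 < g.val x v v)
    (hK : ∀ X Y : TangentSpace I x, g.val x X X = 1 → g.val x Y Y = 1 → g.val x X Y = 0 →
      g.curvatureForm cov x X Y Y X = c)
    {m : ℕ} (hm : finrank ℝ E = m) (X Y Z W : TangentSpace I x) :
    g.curvatureForm cov x X Y Z W =
      c * (g.val x Y Z * g.val x X W - g.val x X Z * g.val x Y W) := by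
  classical
  obtain ⟨b, hb⟩ := g.exists_basis_isOrthonormalFrame (x := x) hpos hm
  -- the pinching hypothesis with `ε = 0`
  have hK' : ∀ X Y : TangentSpace I x, g.val x X X = 1 → g.val x Y Y = 1 → g.val x X Y = 0 →
      |g.curvatureForm cov x X Y Y X - c| ≤ 0 := fun X Y hX hY hXY => by
    rw [hK X Y hX hY hXY, sub_self, abs_zero]
  -- the identity on the orthonormal basis `b`
  have hframe : ∀ i j k l, g.curvatureForm cov x (b i) (b j) (b k) (b l) =
      c * ((if i = l then 1 else 0) * (if j = k then 1 else 0) -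
          (if i = k then 1 else 0) * (if j = l then 1 else 0)) := fun i j k l => by
    have hle := abs_curvatureForm_frame_sub_le h hn hpos le_rfl hK' hb i j k l
    rw [mul_zero] at hle
    exact sub_eq_zero.1 (abs_nonpos_iff.1 hle)
  have hg : ∀ i j, g.val x (b i) (b j) = if i = j then 1 else 0 := fun i j => by
    split_ifs with hij
    · subst hij; exact hb.1 i
    · exact hb.2 i j hij
  -- both sides are 4-linear: compare on the basis
  have key := aux_ext_four b
    (D := fun X Y Z W => g.curvatureForm cov x X Y Z W -
      c * (g.val x Y Z * g.val x X W - g.val x X Z * g.val x Y W))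
    (fun Y Z W => ⟨fun X X' => by
        simp only [curvatureForm, map_add, _root_.add_apply]; ring,
      fun a X => by
        simp only [curvatureForm, map_smul, _root_.smul_apply, smul_eq_mul]; ring⟩)
    (fun X Z W => ⟨fun Y Y' => by
        simp only [curvatureForm, map_add, _root_.add_apply]; ring,
      fun a Y => by
        simp only [curvatureForm, map_smul, _root_.smul_apply, smul_eq_mul]; ring⟩)
    (fun X Y W => ⟨fun Z Z' => by
        simp only [curvatureForm, map_add, _root_.add_apply]; ring,
      fun a Z => by
        simp only [curvatureForm, map_smul, _root_.smul_apply, smul_eq_mul]; ring⟩)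
    (fun X Y Z => ⟨fun W W' => by
        simp only [curvatureForm, map_add]; ring,
      fun a W => by
        simp only [curvatureForm, map_smul, smul_eq_mul]; ring⟩)
    (fun i j k l => by
      rw [hframe i j k l, hg j k, hg i l, hg i k, hg j l, sub_eq_zero]
      ring)
    X Y Z W
  exact sub_eq_zero.1 key

end General

/-- **`K ≡ 1` on orthonormal pairs ⇒ constant sectional curvature `1` as a tensor identity** (Lee 2018, Prop. 8.36; O'Neill 1983, Ch. 3, Cor. 3.42), for the Levi-Civita connection of a Riemannian `C^∞` metric on a 4-manifold. -/
theorem helper_rfg_constantCurvature :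
    ∀ (M : Type) [TopologicalSpace M] [ChartedSpace (EuclideanSpace ℝ (Fin 4)) M] [IsManifold (𝓡 4) ∞ M] (g : Literature.Geometry.Lorentzian.PseudoRiemannianMetric (𝓡 4) ∞ (EuclideanSpace ℝ (Fin 4)) (TangentSpace (𝓡 4) : M → Type _)) [_i : g.HasLeviCivita], g.IsRiemannian → (∀ (x : M) (X Y : TangentSpace (𝓡 4) x), g.val x X X = 1 → g.val x Y Y = 1 → g.val x X Y = 0 → g.curvatureForm g.leviCivita x X Y Y X = 1) → g.HasConstantSectionalCurvatureWith g.leviCivita 1 := by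
  intro M _ _ _ g _ hg hK x X Y Z W
  have hLC : g.IsLeviCivita g.leviCivita := isLeviCivita_leviCivita_holds
  have hn : (2 : ℕ∞ω) ≤ ∞ := WithTop.coe_le_coe.mpr le_top
  exact aux_curvatureForm_eq_of_sectional hLC hn (fun v hv => hg x v hv) (hK x)
    finrank_euclideanSpace_fin X Y Z W

end Summit.SmoothPoincare4.SmoothPoincare4.Cruxes.PEFillNearRound.RoundFilled

end
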